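import Summits.AtomisticToContinuum.BoseEinsteinCondensation.Theorems.BECSwapNoCatastropheTorusHalfSwapOverlapAbsHardLayerPBasics
import Literature.MathematicalPhysics.QuantumManyBody.BoseGasHardLayerCutoff
import HarnessLib

/-!
# Crux `TorusHalfSwapOverlap`, line `registered` (v8, H chain): stub K `stub_hardLayerPCutoff`

Route `BECSwapNoCatastrophe`, crux `TorusHalfSwapOverlap` (stmt-AtomisticToContinuum-14393), line `registered`,
stub K of the hard-core maximal-form bound H on the absolute (symmetry-free) class for PAIR-DEPENDENT profiles
`V i j`. This file is the pair-profile twin of the FIRST HALF of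
`Literature/MathematicalPhysics/QuantumManyBody/BoseGasHardLayerCutoff.lean`, `exists_hardLayer_cutoff`
(dictionary `hardRad v ↦ hardRad (V i j)` per pair, `hardLayer v L s ↦ hardLayerP V L s`; NO permutation
symmetrisation, since the absolute class carries no Bose symmetry):

* `stub_hardLayerPCutoff` — **for `L > 0` and every profile matrix `V` there is `C ≥ 0` such that for every
  `0 < s ≤ L` there is `ξ : (ℝ³)^N → [0, 1]`, `C¹`, torus periodic, `ξ = 0` on `hardLayerP V L (s/2)`, `ξ = 1` on
  the `s/10`-neighbourhood (particle by particle) of the complement of `hardLayerP V L s`, `‖∇ξ‖ ≤ C/s`.**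

Construction: `ξ = 1 - χ ∘ toUnitTorusN L` for the plateau cut-off `χ` (`Torus.exists_plateau_cutoff`) of the
torus image of `hardLayerP V L (s/2)` at scale `δ = s/(100 L)`; `C = 100 c₁ √(3N)` with
`c₁ = Torus.derivProfileMass (Fin N × Fin 3) 1`.

Tagged folklore (smooth partitions of unity adapted to a closed set at a given scale).
-/

noncomputable section

namespace Summit.AtomisticToContinuum.BoseEinsteinCondensation.Cruxes.TorusHalfSwapOverlap.TruncationSplit

open MeasureTheory Filter Topology Set Metric
open scoped ENNReal NNReal InnerProductSpace ComplexConjugate ContDiff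
open Literature.MathematicalPhysics.QuantumManyBody.BoseGas
open Literature.MathematicalPhysics.QuantumManyBody.BoseGas.HardLayerAux
open Literature.Analysis.FunctionSpaces Literature.Analysis.FunctionSpaces.Torus
open Summit.AtomisticToContinuum.BoseEinsteinCondensation.AbsTorus

-- The measure on `ℝ/ℤ` is the Haar PROBABILITY measure, as in `PeriodicFormDomain.lean`.
attribute [local instance] formDomain_measureSpace formDomain_isProbabilityMeasure formDomain_isProbabilityMeasure_pi

/-- Local notation for the Hilbert space `H = L²((ℝ/ℤ)^{3N})`. -/
local notation "L2T " N':max => Lp ℂ 2 (volume : Measure (UnitAddTorus (Fin N' × Fin 3)))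

variable {N : ℕ} {V : Fin N → Fin N → ℝ → ℝ≥0∞} {L : ℝ}

/-! ### Geometry of the pair-profile hard layers under small displacements -/

/-- Moving every particle by at most `ρ` moves a configuration of `hardLayerP V L a` into
`hardLayerP V L (a + 2ρ)` (pair-profile twin of `mem_hardLayer_of_near`; the pair and its `Nonempty` guard are
carried along). [folklore] -/
theorem cutoffP_mem_hardLayerP_of_near {X X' : Config N} {a ρ : ℝ} (hX' : X' ∈ hardLayerP V L a)
    (hnear : ∀ i, ‖X i - X' i‖ ≤ ρ) : X ∈ hardLayerP V L (a + 2 * ρ) := by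
  obtain ⟨i, j, n, hij, hne, h⟩ := hX'
  refine ⟨i, j, n, hij, hne, ?_⟩
  have hd : dist (pairRad L X i j n) (pairRad L X' i j n) ≤ 2 * ρ := by
    rw [Real.dist_eq, pairRad, pairRad]
    have h1 := abs_norm_sub_norm_le (X i - X j - latticeVec L n) (X' i - X' j - latticeVec L n)
    have h2 : ‖X i - X j - latticeVec L n - (X' i - X' j - latticeVec L n)‖ ≤ ρ + ρ := by
      rw [show X i - X j - latticeVec L n - (X' i - X' j - latticeVec L n) = (X i - X' i) - (X j - X' j) by abel]
      exact (norm_sub_le _ _).trans (add_le_add (hnear i) (hnear j))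
    linarith
  have := infDist_le_infDist_add_dist (x := pairRad L X i j n) (y := pairRad L X' i j n) (s := hardRad (V i j))
  linarith

/-! ### The cut-off -/

/-- **Stub K: smooth periodic cut-offs vanishing near the pair-profile hard configurations.** For `L > 0` and
every profile matrix `V` there is `C ≥ 0` such that for every `0 < s ≤ L` there is `ξ : (ℝ³)^N → ℝ` with: `ξ` is
`C¹` and torus periodic, `0 ≤ ξ ≤ 1`, `ξ = 0` on `hardLayerP V L (s/2)`, `ξ = 1` at every configuration each of
whose particles is within `s/10` of a configuration off `hardLayerP V L s`, and `‖∇ξ‖ ≤ C/s` everywhere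
(twin of `exists_hardLayer_cutoff` without the permutation symmetrisation). [folklore] -/
theorem stub_hardLayerPCutoff :
    ∀ (N : ℕ) (L : ℝ), 0 < L → ∀ V : Fin N → Fin N → ℝ → ℝ≥0∞,
      ∃ C : ℝ, 0 ≤ C ∧ ∀ s : ℝ, 0 < s → s ≤ L →
        ∃ ξ : Config N → ℝ, ContDiff ℝ 1 ξ ∧ IsTorusPeriodic L ξ ∧ (∀ X, 0 ≤ ξ X ∧ ξ X ≤ 1) ∧
          (∀ X ∈ hardLayerP V L (s / 2), ξ X = 0) ∧
          (∀ X ∉ hardLayerP V L s, ∀ X' : Config N, (∀ i, ‖X' i - X i‖ < s / 10) → ξ X' = 1) ∧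
          ∀ X, ‖fderiv ℝ ξ X‖ ≤ C / s := by
  intro N L hL V
  classical
  obtain ⟨e, he, henorm⟩ := exists_scaledCoordCLM (N := N) hL
  set c₁ : ℝ := derivProfileMass (Fin N × Fin 3) 1 with hc₁
  have hc₁0 : 0 ≤ c₁ := derivProfileMass_nonneg _
  refine ⟨100 * c₁ * Real.sqrt (3 * N), by positivity, fun s hs hsL => ?_⟩
  -- the scale and the plateau cut-off on the torus
  set δ : ℝ := s / (100 * L) with hδ
  have hδ0 : 0 < δ := by positivity
  have hδ4 : δ ≤ 1 / 4 := by
    rw [hδ, div_le_iff₀ (by positivity)]; linarith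
  have hLδ : 2 * L * (5 * δ) = s / 10 := by rw [hδ]; field_simp; ring
  set ST : Set (UnitAddTorus (Fin N × Fin 3)) := {t | fromUnitTorusN L t ∈ hardLayerP V L (s / 2)} with hST
  obtain ⟨χ, hχs, hχ01, hχ1, hχ0, hχD⟩ := exists_plateau_cutoff ST hδ0 hδ4
  -- membership in `ST` of a covering point
  have hmemST : ∀ Y : Config N, toUnitTorusN L Y ∈ ST ↔ Y ∈ hardLayerP V L (s / 2) := by
    intro Y
    obtain ⟨m, hm⟩ := exists_fromUnitTorusN_toUnitTorusN_eq hL Y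
    simp only [hST, mem_setOf_eq, hm]
    exact add_latticeVecN_mem_hardLayerP_iff Y m _
  -- the cut-off
  set ξ₀ : Config N → ℝ := fun X => 1 - χ (toUnitTorusN L X) with hξ₀
  have hξ₀eq : ξ₀ = fun X => 1 - lift χ (e X) := by
    funext X; simp only [hξ₀, lift_apply, he]
  have hχdiff : ContDiff ℝ ∞ (lift χ) := hχs
  have hξ₀diff : ContDiff ℝ ∞ ξ₀ := by
    rw [hξ₀eq]; exact contDiff_const.sub (hχdiff.comp e.contDiff)
  have hξ₀01 : ∀ X, 0 ≤ ξ₀ X ∧ ξ₀ X ≤ 1 := fun X => by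
    have := hχ01 (toUnitTorusN L X)
    exact ⟨by simp only [hξ₀]; linarith [this.2], by simp only [hξ₀]; linarith [this.1]⟩
  have hξ₀zero : ∀ X ∈ hardLayerP V L (s / 2), ξ₀ X = 0 := by
    intro X hX
    simp only [hξ₀]
    rw [hχ1 _ (self_subset_thickening hδ0 ST ((hmemST X).2 hX)), sub_self]
  have hξ₀one : ∀ X ∉ hardLayerP V L s, ∀ X' : Config N, (∀ i, ‖X' i - X i‖ < s / 10) → ξ₀ X' = 1 := by
    intro X hX X' hX'
    simp only [hξ₀]
    rw [hχ0 _ ?_, sub_zero]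
    intro hmem
    rw [mem_thickening_iff] at hmem
    obtain ⟨t'', ht'', hdist⟩ := hmem
    obtain ⟨X'', hX''t, hX''near⟩ := exists_lift_near hL X' (by positivity) hdist
    have hX''mem : X'' ∈ hardLayerP V L (s / 2) := (hmemST X'').1 (hX''t ▸ ht'')
    have h1 : X' ∈ hardLayerP V L (s / 2 + 2 * (s / 10)) :=
      cutoffP_mem_hardLayerP_of_near hX''mem fun i => by rw [← hLδ]; exact (hX''near i).le
    have h2 : X ∈ hardLayerP V L (s / 2 + 2 * (s / 10) + 2 * (s / 10)) :=
      cutoffP_mem_hardLayerP_of_near h1 fun i => by rw [norm_sub_rev]; exact (hX' i).le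
    exact hX (hardLayerP_mono V L (by linarith) h2)
  have hξ₀per : IsTorusPeriodic L ξ₀ := by
    intro Y i k
    simp only [hξ₀]
    rw [toUnitTorusN_add, toUnitTorusN_single_single hL.ne', add_zero]
  have hξ₀D : ∀ X, ‖fderiv ℝ ξ₀ X‖ ≤ 100 * c₁ * Real.sqrt (3 * N) / s := by
    intro X
    have h1 : HasFDerivAt (fun X => lift χ (e X)) ((fderiv ℝ (lift χ) (e X)).comp e) X :=
      (hχdiff.differentiable (by simp)).differentiableAt.hasFDerivAt.comp X e.hasFDerivAt
    have h2 : HasFDerivAt ξ₀ (0 - (fderiv ℝ (lift χ) (e X)).comp e) X := by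
      rw [hξ₀eq]; exact (hasFDerivAt_const 1 X).sub h1
    rw [h2.fderiv, zero_sub, norm_neg]
    have h3 : ‖fderiv ℝ (lift χ) (e X)‖ ≤ c₁ * (δ ^ 1)⁻¹ := by
      rw [← norm_iteratedFDeriv_zero (𝕜 := ℝ) (f := fderiv ℝ (lift χ)), norm_iteratedFDeriv_fderiv]
      exact hχD 1 (e X)
    have h4 : ‖e‖ ≤ Real.sqrt (3 * N) / L :=
      ContinuousLinearMap.opNorm_le_bound _ (by positivity) henorm
    calc ‖(fderiv ℝ (lift χ) (e X)).comp e‖ ≤ ‖fderiv ℝ (lift χ) (e X)‖ * ‖e‖ := ContinuousLinearMap.opNorm_comp_le _ _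
      _ ≤ c₁ * (δ ^ 1)⁻¹ * (Real.sqrt (3 * N) / L) :=
          mul_le_mul h3 h4 (norm_nonneg _) (mul_nonneg hc₁0 (by positivity))
      _ = 100 * c₁ * Real.sqrt (3 * N) / s := by rw [hδ, pow_one]; field_simp
  exact ⟨ξ₀, hξ₀diff.of_le (by exact_mod_cast le_top), hξ₀per, hξ₀01, hξ₀zero, hξ₀one, hξ₀D⟩

end Summit.AtomisticToContinuum.BoseEinsteinCondensation.Cruxes.TorusHalfSwapOverlap.TruncationSplit

end
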